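import Summits.Ventures.CertifiedManyBodySolver.Rows.TorusCeilingLatHom

/-!
# Sketch (hub-lb-idea-10 g3, LINE idea10-L4 «T20 DECIDER») — kernel tier of the carrier T20

HONEST FRAMING: a certified bound is a number with a certificate; nothing here predicts superconductivity.

`T20 = ℤ²/⟨(4,2),(−2,4)⟩` (= HNF `⟨(10,0),(4,2)⟩`, the √20×√20 Betts cluster, quotient `ℤ/2 × ℤ/10`,
bipartite, C4- but not reflection-invariant). Five-copy presentation inside `(ℤ/10)²`:
`t20Hom = latHom 10 [[5,0],[-3,1]]`, `(x,y) ↦ (5x, y − 3x) mod 10`; kernel exactly `⟨(4,2),(−2,4)⟩`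
(image `{(0,k),(5,k)} ≅ ℤ/2 × ℤ/10`, index 5 in `(ℤ/10)²`). The lemmas below are the hypotheses `hd` /
`hInj'` of Part IV `homTorus_minEnergyOn_div_ge_of_window_certificate` for the word classes T20 hosts:
4×4 boxes (spreads ≤ 3,3), two-leg ladders and axial lines up to 10 sites in either orientation
(spreads ≤ 1,9 / 9,1). First lemma of the crux idea `t20-decider` (stmt-Ventures-21721).
-/

noncomputable section

open Matrix Finset
open Literature.MathematicalPhysics.QuantumLattice
open Literature.MathematicalPhysics.QuantumFieldTheory hiding Site
open Literature.MathematicalPhysics.QuantumManyBody.StateRelaxation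
open Literature.Probability.LatticeModels
open HubbardWave0
open scoped ComplexOrder ComplexConjugate

namespace Summit.Ventures.CertifiedManyBodySolver.Rows

/-- Five-copy presentation of `T20 = ℤ²/⟨(4,2),(−2,4)⟩` in `(ℤ/10)²`: `(x,y) ↦ (5x, −3x + y)`. [folklore] -/
def t20Hom : Site 2 →+ TorusSite 2 10 := latHom 10 ![![5, 0], ![-3, 1]]

/-- Both generators of `⟨(4,2),(−2,4)⟩` lie in the kernel of `t20Hom`. [folklore] -/
theorem t20Hom_generators : t20Hom ![4, 2] = 0 ∧ t20Hom ![-2, 4] = 0 := by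
  refine ⟨?_, ?_⟩ <;> funext j <;>
    simp only [t20Hom, latHom_apply, Fin.sum_univ_two, Matrix.cons_val_zero, Matrix.cons_val_one,
      Pi.zero_apply] <;>
    match j with
    | 0 => decide
    | 1 => decide

/-- The four signed hops `±(5,−3), ±(0,1)` of `t20Hom` are pairwise distinct in `(ℤ/10)²`
(non-degenerate nearest-neighbour bonds; hypothesis `hd` of Part IV). [folklore] -/
theorem injective_signedHop_t20Hom : Function.Injective (signedHop t20Hom) :=
  injective_signedHop_latHom 10 ![![5, 0], ![-3, 1]] (by decide)

/-- `t20Hom` is injective on every window of coordinate spreads `≤ 3, ≤ 3` (all 4×4-box words). [folklore] -/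
theorem injOn_t20Hom_of_spread_3_3 {S : Finset (Site 2)}
    (hspread : ∀ x ∈ S, ∀ y ∈ S, |x 0 - y 0| ≤ (3 : ℤ) ∧ |x 1 - y 1| ≤ (3 : ℤ)) :
    Set.InjOn t20Hom ↑S :=
  injOn_latHom_two_two_of_spread 10 ![![5, 0], ![-3, 1]] (M₀ := 3) (M₁ := 3)
    (fun a' b' h₁ h₂ h₃ h₄ h₅ h₆ => by
      simp only [Matrix.cons_val_zero, Matrix.cons_val_one] at h₅ h₆
      omega) hspread

/-- `t20Hom` is injective on every window of spreads `≤ 1, ≤ 9` (two-leg ladders / axial lines of up to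
10 sites along `y`). [folklore] -/
theorem injOn_t20Hom_of_spread_1_9 {S : Finset (Site 2)}
    (hspread : ∀ x ∈ S, ∀ y ∈ S, |x 0 - y 0| ≤ (1 : ℤ) ∧ |x 1 - y 1| ≤ (9 : ℤ)) :
    Set.InjOn t20Hom ↑S :=
  injOn_latHom_two_two_of_spread 10 ![![5, 0], ![-3, 1]] (M₀ := 1) (M₁ := 9)
    (fun a' b' h₁ h₂ h₃ h₄ h₅ h₆ => by
      simp only [Matrix.cons_val_zero, Matrix.cons_val_one] at h₅ h₆
      omega) hspread

/-- `t20Hom` is injective on every window of spreads `≤ 9, ≤ 1` (two-leg ladders / axial lines of up to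
10 sites along `x`). [folklore] -/
theorem injOn_t20Hom_of_spread_9_1 {S : Finset (Site 2)}
    (hspread : ∀ x ∈ S, ∀ y ∈ S, |x 0 - y 0| ≤ (9 : ℤ) ∧ |x 1 - y 1| ≤ (1 : ℤ)) :
    Set.InjOn t20Hom ↑S :=
  injOn_latHom_two_two_of_spread 10 ![![5, 0], ![-3, 1]] (M₀ := 9) (M₁ := 1)
    (fun a' b' h₁ h₂ h₃ h₄ h₅ h₆ => by
      simp only [Matrix.cons_val_zero, Matrix.cons_val_one] at h₅ h₆
      omega) hspread

end Summit.Ventures.CertifiedManyBodySolver.Rows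

end
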